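import Summits.QuantumAdvantage.QuantumAdvantage.Theorems.CubicForrelationNearExactIsExactTwelveLevelSixOffFlat255
import Summits.QuantumAdvantage.QuantumAdvantage.Theorems.CubicForrelationNearExactIsExactTwelveLevelSixH34RigidWt
import Summits.QuantumAdvantage.QuantumAdvantage.Theorems.CubicForrelationNearExactIsExactTwelveLevelSixEight767
import Summits.QuantumAdvantage.QuantumAdvantage.Theorems.CubicForrelationNearExactIsExactTwelveLevelSixBothGt930
import Summits.QuantumAdvantage.QuantumAdvantage.Theorems.CubicForrelationNearExactIsExactTwelveLevelSixOnZMod8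
import Summits.QuantumAdvantage.QuantumAdvantage.Theorems.CubicForrelationNearExactIsExactTwelveClosedGt2932

/-!
# Crux `CubicForrelation.NearExactIsExact` (stmt-QuantumAdvantage-14043) — n = 12 AT the boundary `Φ = 29/32`, both sides at level `≥ 6`
  (budget `Σ e² = 768` exactly): REDUCTION to three residual configurations — `#Z = 768`, or `#Z = 512` with off-flat energy exactly `256`,
  or `#Z = 512` with `8 ∣ e` off the 9-flat `Z`

Certificate seat `b2b-cforr-cert` (gen 22).  HONEST FRAMING: a kernel-checked REDUCTION lemma (standard axioms, no `decide`) about cubic Boolean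
pairs on 12 bits — the level-`≥ 6` × level-`≥ 6` branch of the boundary rung `29/32` (HOME/b2b-cforr-cert-g22/PLAN-N12-928-EQ.md).  By
`tw22_window_gt2932_false` the pair sits exactly at `Φ = 29/32`, so `Σ e² = 768` (`e = u'' − (−1)^f`, `W_g = 64u''`); the even set `Z` of `u''`
is the support of a cubic (not empty: `g` is not bent, `tw_bent_end`), so `#Z ≥ 512`, and `#Z ≤ Σ e² = 768` with `#Z < 768 ⇒ #Z = 512`
(`sw_cubic_second_weight`).  For `#Z = 512` the off-flat energy is `≤ 256`; when it is `≤ 255` gen 20's trichotomy `tw20_off_flat_lt256` applies and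
its sparse / rigid exceptions die VERBATIM (`tw18_levelSix_sparse9_false 255 128`: `765 + 512 < 1440`; `tw16_levelSix_sparse7_false 255 64`:
`765 + 256 < 1440`), leaving the branch `8 ∣ e` off `Z` — whose ℓ¹ engine `tw20_levelSix_eight_partner_false767` needs `Σ e² ≤ 767` and is NOT
available at `768` (`#L = 32` becomes possible).  Nothing is closed here; NO new value of `θ₁₂`.  NOT summit progress.

References: Ax (1964) / McEliece (1972); MacWilliams–Sloane (1977) Ch. 13–15; Carlet (2021) §5.2; O'Donnell (2014) §3.3.  Axioms: standard.
-/

set_option linter.dupNamespace false -- D-0017: single-problem summit ⇒ `QuantumAdvantage.QuantumAdvantage` by design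

noncomputable section

namespace Summit.QuantumAdvantage.QuantumAdvantage.Theorems.CubicForrelation.NearExactIsExact

open Finset
open Literature.Computability.QuantumComplexity
open Literature.Computability.QuantumComplexity.BuzetChailloux (bxor zeroVec bxor_bxor_cancel_left bxor_zeroVec zeroVec_bxor bxor_comm
  bxor_self)
open Literature.Computability.QuantumComplexity.DerivativeWalsh (W)

/-- **Level `≥ 6` × level `≥ 6` at `29/32 ≤ Φ < 1`: reduction to three residual configurations** (12 bits).  See the module docstring.
Finite-slice statement, NOT summit progress. [this work] -/
theorem tw22_levelSix_both_ge2932_reduction (f g : (Fin (6 + 6) → Bool) → Bool) (hf : IsDegLeFun 3 f) (hg : IsDegLeFun 3 g)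
    (u'' : (Fin (6 + 6) → Bool) → ℤ) (hu'' : ∀ x, W (fun y => signOf (g y)) x = (2 : ℝ) ^ 6 * (u'' x : ℝ))
    (wf : (Fin (6 + 6) → Bool) → ℤ) (hwf : ∀ y, W (fun x => signOf (f x)) y = (2 : ℝ) ^ 6 * (wf y : ℝ))
    (hlo : (29 / 32 : ℝ) ≤ forrelation f g) (hhi : forrelation f g < 1) :
    forrelation f g = 29 / 32 ∧ (∑ x, (u'' x - sZ (f x)) ^ 2 : ℤ) = 768 ∧
    (#(univ.filter fun x : Fin (6 + 6) → Bool => ¬ Odd (u'' x)) = 768 ∨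
     (#(univ.filter fun x : Fin (6 + 6) → Bool => ¬ Odd (u'' x)) = 512 ∧
      (∑ x ∈ univ.filter (fun x => x ∉ univ.filter (fun x : Fin (6 + 6) → Bool => ¬ Odd (u'' x))), (u'' x - sZ (f x)) ^ 2 = 256 ∨
       ∀ y, y ∉ univ.filter (fun x : Fin (6 + 6) → Bool => ¬ Odd (u'' x)) → (8 : ℤ) ∣ u'' y - sZ (f y)))) := by
  classical
  -- `u = 4u''` at the Ax level `4`
  set u : (Fin (6 + 6) → Bool) → ℤ := fun x => 4 * u'' x with hudef
  have hu : ∀ x, W (fun y => signOf (g y)) x = (2 : ℝ) ^ 4 * (u x : ℝ) := by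
    intro x; rw [hu'' x]; simp only [u]; push_cast; ring
  -- the residual `e = u'' − s` and its budget `B = Σ e² = 8192(1 − Φ) < 768`
  set e : (Fin (6 + 6) → Bool) → ℤ := fun x => u'' x - sZ (f x) with hedef
  have hFe : ∀ y, u y - 4 * sZ (f y) = 4 * e y := fun y => by simp only [u, e]; ring
  have hbud := tw12_budget f g u hu
  have h16 : ∀ x, (u x - 4 * sZ (f x)) ^ 2 = 16 * e x ^ 2 := fun x => by rw [hFe]; ring
  have hBR : ((∑ x, e x ^ 2 : ℤ) : ℝ) = 8192 * (1 - forrelation f g) := by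
    have h' : ((∑ x, (u x - 4 * sZ (f x)) ^ 2 : ℤ) : ℝ) = 16 * ((∑ x, e x ^ 2 : ℤ) : ℝ) := by
      rw [sum_congr rfl fun x _ => h16 x, ← mul_sum]; push_cast; ring
    rw [h'] at hbud
    linarith
  -- exactly at the boundary: `Φ = 29/32`, `Σ e² = 768`
  have hΦeq : forrelation f g = 29 / 32 := by
    by_contra hne
    exact tw22_window_gt2932_false f g hf hg (lt_of_le_of_ne hlo (Ne.symm hne)) hhi
  have hBeq : (∑ x, e x ^ 2 : ℤ) = 768 := by
    have h' : ((∑ x, e x ^ 2 : ℤ) : ℝ) = 768 := by rw [hBR, hΦeq]; norm_num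
    exact_mod_cast h'
  have hB_le : (∑ x, e x ^ 2 : ℤ) ≤ 768 := hBeq.le
  refine ⟨hΦeq, hBeq, ?_⟩
  -- even points of `u''` cost `≥ 1`
  set Z := univ.filter (fun x : Fin (6 + 6) → Bool => ¬ Odd (u'' x)) with hZdef
  have hmemZ : ∀ x, x ∈ Z ↔ ¬ Odd (u'' x) := fun x => by simp [hZdef]
  have heodd : ∀ x, x ∈ Z → Odd (e x) := by
    intro x hx
    have hev := Int.not_odd_iff_even.1 ((hmemZ x).1 hx)
    rcases tp_sZ_cases (f x) with hs | hs <;> simp only [e] <;> rw [hs]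
    · exact Int.odd_sub.2 (iff_of_false (Int.not_odd_iff_even.2 hev) (by decide))
    · exact Int.odd_sub.2 (iff_of_false (Int.not_odd_iff_even.2 hev) (by decide))
  have hsq1 : ∀ x, x ∈ Z → 1 ≤ e x ^ 2 := by
    intro x hx
    have h0 := Int.odd_iff.1 (heodd x hx)
    have : e x ≤ -1 ∨ 1 ≤ e x := by omega
    have := tp_sq_ge (k := 1) (by norm_num) this
    linarith
  have hsplit : (∑ x, e x ^ 2 : ℤ) = ∑ x ∈ Z, e x ^ 2 + ∑ x ∈ univ.filter (fun x => x ∉ Z), e x ^ 2 := by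
    rw [← sum_filter_add_sum_filter_not univ (fun x => x ∈ Z)]
    congr 1
    exact sum_congr (by ext x; simp) fun _ _ => rfl
  have hZle : (#Z : ℤ) ≤ 768 := by
    have h2 : ∑ x ∈ Z, (1 : ℤ) ≤ ∑ x ∈ Z, e x ^ 2 := sum_le_sum fun x hx => hsq1 x hx
    rw [sum_const, nsmul_eq_mul, mul_one] at h2
    linarith [sum_nonneg fun x (_ : x ∈ univ.filter (fun x => x ∉ Z)) => sq_nonneg (e x)]
  -- Parseval at level 6: `Σ u''² = 4096`
  have hpar : ∑ x, u'' x ^ 2 = 4096 := by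
    have h := zms_sum_u_sq 2 g u (fun x => (hu x).trans (by norm_num))
    have e : ∑ x, ((u x : ℝ)) ^ 2 = 16 * ∑ x, ((u'' x : ℝ)) ^ 2 := by
      rw [mul_sum]; exact sum_congr rfl fun x _ => by simp only [u]; push_cast; ring
    rw [e] at h
    norm_num at h
    have h' : ∑ x, ((u'' x : ℝ)) ^ 2 = 4096 := by linarith
    exact_mod_cast h'
  by_cases hall : ∀ x, Odd (u'' x)
  · -- every `u''` odd: `g` is bent, `Φ = 1` or `Φ ≤ 7/8`
    have hsq1' : ∀ x, u'' x ^ 2 = 1 := by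
      have hge : ∀ x, (1 : ℤ) ≤ u'' x ^ 2 := fun x => by
        have h0 := Int.odd_iff.1 (hall x)
        have : u'' x ≤ -1 ∨ 1 ≤ u'' x := by omega
        have := tp_sq_ge (k := 1) (by norm_num) this
        linarith
      have hsum0 : ∑ x, (u'' x ^ 2 - 1 : ℤ) = 0 := by
        rw [sum_sub_distrib, hpar, sum_const, card_univ, Fintype.card_fun, Fintype.card_bool, Fintype.card_fin]; norm_num
      intro x
      have := (sum_eq_zero_iff_of_nonneg fun y _ => by have := hge y; linarith).1 hsum0 x (mem_univ x)
      linarith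
    have hbent : ∀ x, W (fun y => signOf (g y)) x ^ 2 = (2 : ℝ) ^ (6 + 6) := by
      intro x
      rw [hu'' x, mul_pow]
      have : ((u'' x : ℝ)) ^ 2 = 1 := by exact_mod_cast hsq1' x
      rw [this]; norm_num
    rcases tw_bent_end (by norm_num) f g hf hg hbent with h | h
    · rw [h] at hhi; norm_num at hhi
    · norm_num at h; linarith
  push Not at hall
  obtain ⟨x₁, hx₁⟩ := hall
  -- the parity of `u''` is cubic; `Z` has exactly `512` points and is a 9-flat
  have hp : IsDegLeFun 3 (fun x => decide (Odd (u'' x))) :=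
    stub_walshTower stub_axParity (6 + 6) 6 3 g u'' hg hu'' (by intro k hk hkn; omega)
  have hp' : IsDegLeFun (2 + 1) (fun x => decide (Odd (u'' x)) ^^ true) := tb_isDegLeFun_xor_const hp true
  have hfilt : (univ.filter fun x : Fin (6 + 6) → Bool => (decide (Odd (u'' x)) ^^ true) = true) = Z :=
    filter_congr fun x _ => by simp
  have hne : ∃ x, (decide (Odd (u'' x)) ^^ true) = true := ⟨x₁, by simpa using hx₁⟩
  have hRM := bb_rmWeight_holds (6 + 6) 3 (fun x => decide (Odd (u'' x)) ^^ true) hp' hne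
  rw [hfilt] at hRM
  have hZge : 512 ≤ #Z := by norm_num at hRM; omega
  by_cases hZ768 : #Z = 768
  · exact Or.inl hZ768
  right
  have hZcard : #Z = 512 := by
    have hZle' : #Z ≤ 768 := by exact_mod_cast hZle
    have hsw := sw_cubic_second_weight (m := 6 + 6) _ hp' hne (by rw [hfilt]; norm_num; omega)
    rw [hfilt] at hsw
    norm_num at hsw
    omega
  refine ⟨hZcard, ?_⟩
  have hmw := mw_flat_of_minweight 2 (fun x => decide (Odd (u'' x)) ^^ true) hp' (by rw [hfilt, hZcard]; norm_num)
  rw [hfilt] at hmw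
  obtain ⟨h0, hadd, hcardV, hcoset⟩ := hmw
  set V₀ := univ.filter (fun a : Fin (6 + 6) → Bool => ∀ x,
    (decide (Odd (u'' (bxor x a))) ^^ true) = (decide (Odd (u'' x)) ^^ true)) with hV₀
  obtain ⟨xZ, hxZ⟩ : Z.Nonempty := card_pos.1 (by rw [hZcard]; norm_num)
  have hS : Z = V₀.image (bxor xZ) := hcoset xZ (by have h := (hmemZ xZ).1 hxZ; simpa using h)
  rw [hZcard] at hcardV
  have hcardV9 : #V₀ = 2 ^ 9 := by rw [hcardV]; norm_num
  -- budget split: `Σ_Z e² ≥ 512`, so off `Z` at most `256`; exactly `256` is the second residual configuration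
  have hZsum_ge : (512 : ℤ) ≤ ∑ x ∈ Z, e x ^ 2 := by
    have h1 : ∑ x ∈ Z, (1 : ℤ) ≤ ∑ x ∈ Z, e x ^ 2 := sum_le_sum fun x hx => hsq1 x hx
    rw [sum_const, nsmul_eq_mul, mul_one, hZcard] at h1
    exact_mod_cast h1
  by_cases h256 : ∑ x ∈ univ.filter (fun x => x ∉ Z), e x ^ 2 = 256
  · exact Or.inl h256
  right
  have hoff_le : ∑ x ∈ univ.filter (fun x => x ∉ Z), e x ^ 2 ≤ 255 := by
    have : ∑ x ∈ univ.filter (fun x => x ∉ Z), e x ^ 2 ≤ 256 := by linarith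
    omega
  rcases tw20_off_flat_lt256 255 (by norm_num) f g hf hg u'' hu'' V₀ xZ h0 hadd hcardV9 hS hoff_le with
      h8 | ⟨y₁, y₂, hy₁, hy₂, hy₁₂, hoff, hc₁, hc₂, h128⟩ | ⟨y₁, y₂, y₃, hy₁, hy₂, hy₃, hy₁₂, hy₁₃, hy₂₃, hΩC, hΩwt, h192⟩
  · /- `8 ∣ e` off `Z`: the third residual configuration (the ℓ¹ engine needs `Σ e² ≤ 767`) -/
    exact h8
  · /- the sparse two-coset exception: `Σ_Z (e² − 1) ≤ 96`, (H3)/(H4) by avoidance, no `|e| ∈ {3,5}` on `Z`, then the two-sided kill -/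
    exfalso
    have hDZ : ∑ x ∈ Z, (e x ^ 2 - 1) ≤ 128 := by
      rw [sum_sub_distrib, sum_const, nsmul_eq_mul, mul_one, hZcard]
      push_cast
      linarith
    obtain ⟨H3, H4⟩ := tw15_H34_avoid f g hf hg u'' hu'' V₀ xZ h0 hadd hcardV hS y₁ y₂ hy₁ hy₂ hy₁₂ hoff hc₁ hc₂
    have hvals := tw20_onZ_mod8_values f u'' V₀ xZ h0 hadd hcardV hS (by linarith) H3 H4
    -- on `Z`: `e² ∈ {1, 49, 81}` (the budget `128` excludes `e² ≥ 225`, and `e ≡ σ (mod 8)` excludes `±3, ±5, ±11`)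
    have hZ1 : ∀ x ∈ Z, e x ^ 2 = 1 ∨ e x ^ 2 = 49 ∨ e x ^ 2 = 81 := by
      intro x hx
      rcases hvals x hx with h1 | h49 | h81 | h225
      · exact Or.inl h1
      · exact Or.inr (Or.inl h49)
      · exact Or.inr (Or.inr h81)
      · exfalso
        have h2 : e x ^ 2 - 1 ≤ ∑ y ∈ Z, (e y ^ 2 - 1) :=
          single_le_sum (f := fun y => e y ^ 2 - 1) (fun y hy => by linarith [hsq1 y hy]) hx
        change 225 ≤ e x ^ 2 at h225
        linarith
    exact tw18_levelSix_sparse9_false 255 128 (by norm_num) f g hf hg u'' hu'' wf hwf (by linarith) hhi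
      V₀ xZ h0 hadd hcardV hS hZ1 hDZ hoff_le H3 H4
  · /- the RIGID exception: `Σ_Z (e² − 1) ≤ 64`, (H3)/(H4) by weighted few-hit transversals (weight budget `≤ 63`), at most one mild wild
       point (`e² = 49`) on `Z` -/
    exfalso
    have hDZ : ∑ x ∈ Z, (e x ^ 2 - 1) ≤ 64 := by
      rw [sum_sub_distrib, sum_const, nsmul_eq_mul, mul_one, hZcard]
      push_cast
      linarith
    have hwt63 : #(univ.filter fun ω => ω ∉ Z ∧ ¬ (8 : ℤ) ∣ e ω) +
        #((univ.filter fun ω => ω ∉ Z ∧ ¬ (8 : ℤ) ∣ e ω).filter fun y => e y ^ 2 ≠ 4) ≤ 63 := by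
      change 4 * (#(univ.filter fun ω => ω ∉ Z ∧ ¬ (8 : ℤ) ∣ e ω) : ℤ) +
        12 * #((univ.filter fun ω => ω ∉ Z ∧ ¬ (8 : ℤ) ∣ e ω).filter fun ω => e ω ^ 2 ≠ 4) ≤ 255 at hΩwt
      omega
    obtain ⟨H3, H4⟩ := tw20_H34_rigid_wt f g hf hg u'' hu'' V₀ xZ h0 hadd hcardV hS
      (univ.filter fun ω => ω ∉ Z ∧ ¬ (8 : ℤ) ∣ e ω) y₁ y₂ y₃ hy₁ hy₂ hy₃ hy₁₂ hy₁₃ hy₂₃ hΩC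
      (fun y hy h8 => mem_filter.2 ⟨mem_univ _, hy, h8⟩) hwt63
    have hvals := tw20_onZ_mod8_values f u'' V₀ xZ h0 hadd hcardV hS (by linarith) H3 H4
    have hZ1 : ∀ x ∈ Z, e x ^ 2 = 1 ∨ e x ^ 2 = 49 := by
      intro x hx
      have h2 : e x ^ 2 - 1 ≤ ∑ y ∈ Z, (e y ^ 2 - 1) :=
        single_le_sum (f := fun y => e y ^ 2 - 1) (fun y hy => by linarith [hsq1 y hy]) hx
      rcases hvals x hx with h1 | h49 | h81 | h225
      · exact Or.inl h1
      · exact Or.inr h49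
      · exfalso; change e x ^ 2 = 81 at h81; linarith
      · exfalso; change 225 ≤ e x ^ 2 at h225; linarith
    exact tw16_levelSix_sparse7_false 255 64 (by norm_num) f g hf hg u'' hu'' wf hwf (by linarith) hhi
      V₀ xZ h0 hadd hcardV hS hZ1 hDZ hoff_le H3 H4


end Summit.QuantumAdvantage.QuantumAdvantage.Theorems.CubicForrelation.NearExactIsExact

end
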